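import Literature.Combinatorics.Additive.PollardFourThirds
import Summits.MatrixMultiplication.MatrixMultiplication.Theorems.AbelianSTPPCensusGW2Defs
import Summits.MatrixMultiplication.MatrixMultiplication.Theorems.AbelianSTPPCensusFP2Sound

/-!
# Rule U11-GW2: one class pair of an STPP family passes `GW2.ClassOK` (Grynkiewicz–Wang floor or size-feasible structural branch)

Cell mm-stpp (rung F-M1), theory lane (seat mm-stpp-theory, gen 16).  First half of the soundness proof of rule U11-GW2 (`GW2.GW2Adm`, file
`AbelianSTPPCensusGW2Defs`); the assembly over the four class pairs of an index-2 subgroup and the existence of such a subgroup are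
`AbelianSTPPCensusGW2Sound.lean`.  Setting: an `IsSTPP` family `(A_i, B_i, C_i)` in a finite abelian group `H`, `X = ⋃(B_j − A_j)`,
`Y = ⋃(C_k − B_k)`, `Z′ = ⋃(C_i − A_i)` (`r_{X,Y}(c − a) = b_i` on `C_i − A_i`, `STPPRepCount.repCount_eq`), `cap = max_i b_i`; a CLASS PAIR
is `U ⊆ X`, `V ⊆ Y` with target `T ⊆ Z′`, all inside cosets (size `k`) of a subgroup `K`: `U + V ⊆ C_T ⊇ T`, `V ⊆ C_V ∋ w − u`.

THE NEW STEP (`GW2.classOK_of_isSTPP`): apply the KERNEL theorem Grynkiewicz–Wang 2026 Thm 1.8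
(`GrynkiewiczWang.grynkiewiczWang2026_thm_1_8`, seat mm-stpp-lit g19; consumer form `GW2.gw_dichotomy`) to the pair `(U, V)` at a level
`t > cap`.  Either the floor `t(|U| + |V|) ≤ N_t(U,V) + ⌊(4t² − 2t)/3⌋` holds — and `N_t(U,V) ≤ n + t(k − |T|)` with `n = Σ_{w ∈ T} r_{U,V}(w)`
— or the structural branch: its `t`-popular set `S = U′ + V′` has `r_{X,Y} ≥ r_{U,V} ≥ t > b_i` on it, so `S ∩ Z′ = ∅` and `S ⊆ C_T ∖ T`
(`|S| ≤ k − |T|`); `S` is a non-empty union of cosets of its period group, whose order `h ≥ 2` divides `k` (it stabilises a subset of one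
coset of `K`: `AddSubgroup.card_dvd_of_le`), and Kneser (`card_add_card_le_card_add_add_card_addStab`, tree `Literature…Kneser`) gives
`|S| ≥ |U′| + |V′| − h ≥ |U| + |V| − (t − 1) − h` besides `|S| ≥ |U′|, |V′|`: together `GW2.sizeLB |U| |V| h t ≤ k − |T|`, and the printed
stabiliser bound gives `t(|U| + |V| + |T|) ≤ n + t(k + h)`.  Plus the ceilings `n ≤ |U||V|`, `n ≤ |T|·min(|U|,|V|)` and the pigeonhole
floor `|T|·(|U| + |V| − k) ≤ n`.  Standard axioms only.
WHAT THIS IS NOT: no census number and no `ω` statement — a lemma file of a necessary condition.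

## References
* D. J. Grynkiewicz, R. Wang, *Pollard's theorem in general abelian groups*, arXiv:2601.17922 (2026), Theorem 1.8 [tree:
  `Literature.Combinatorics.Additive.PollardFourThirds`].
* M. Kneser, Math. Z. 58 (1953) 459–484 [tree: `Literature.Combinatorics.Additive.Kneser`].
* H. Cohn, R. Kleinberg, B. Szegedy, C. Umans, FOCS 2005, Def. 5.1 (`IsSTPP`).
-/

set_option linter.dupNamespace false -- `MatrixMultiplication.MatrixMultiplication` (summit = problem, D-0017)
set_option autoImplicit false

namespace Summit.MatrixMultiplication.MatrixMultiplication.Theorems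

open Finset Literature.Computability.AlgebraicComplexity Literature.Combinatorics.Additive
open scoped Pointwise

namespace GW2

section Generic

variable {H : Type*} [AddCommGroup H] [DecidableEq H]

/-- `repCount` is monotone in both sets. [bookkeeping] -/
theorem repCount_mono {U U' V V' : Finset H} (hU : U ⊆ U') (hV : V ⊆ V') (w : H) :
    repCount U V w ≤ repCount U' V' w := by
  unfold repCount
  exact card_le_card (filter_subset_filter _ (product_subset_product hU hV))

/-- `r_{U,V}(w) = #{u ∈ U : w − u ∈ V}`. [bookkeeping] -/
theorem repCount_eq_card_filter (U V : Finset H) (w : H) :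
    repCount U V w = (U.filter fun u => w - u ∈ V).card := by
  unfold repCount
  refine card_bij' (fun p _ => p.1) (fun u _ => (u, w - u)) ?_ ?_ ?_ ?_
  · intro p hp
    simp only [mem_filter, mem_product] at hp ⊢
    refine ⟨hp.1.1, ?_⟩
    rw [← hp.2, add_sub_cancel_left]; exact hp.1.2
  · intro u hu
    simp only [mem_filter, mem_product] at hu ⊢
    exact ⟨⟨hu.1, hu.2⟩, add_sub_cancel u w⟩
  · intro p hp
    simp only [mem_filter, mem_product] at hp
    ext
    · rfl
    · simp only; rw [← hp.2, add_sub_cancel_left]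
  · intro u _; rfl

/-- `r_{U,V}(w) ≤ |U|`. [bookkeeping] -/
theorem repCount_le_card_left (U V : Finset H) (w : H) : repCount U V w ≤ U.card := by
  rw [repCount_eq_card_filter]; exact card_filter_le _ _

/-- `r_{U,V}(w) ≤ |V|`. [bookkeeping] -/
theorem repCount_le_card_right (U V : Finset H) (w : H) : repCount U V w ≤ V.card := by
  rw [repCount_eq_card_filter]
  refine card_le_card_of_injOn (fun u => w - u) (fun u hu => (mem_filter.mp hu).2) ?_
  intro u _ u' _ (huu : w - u = w - u')
  exact sub_right_injective huu

/-- **Pigeonhole in a coset.**  If `V ⊆ C` and `w − u ∈ C` for every `u ∈ U`, then `|U| + |V| ≤ |C| + r_{U,V}(w)`. [folklore] -/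
theorem card_add_card_le_card_add_repCount {U V C : Finset H} {w : H} (hV : V ⊆ C) (hU : ∀ u ∈ U, w - u ∈ C) :
    U.card + V.card ≤ C.card + repCount U V w := by
  rw [repCount_eq_card_filter]
  set U' := U.image fun u => w - u
  have hinj : Set.InjOn (fun u => w - u) ↑U := fun u _ u' _ (h : w - u = w - u') => sub_right_injective h
  have hU'c : U'.card = U.card := card_image_of_injOn hinj
  have hU'C : U' ⊆ C := fun x hx => by
    obtain ⟨u, hu, rfl⟩ := mem_image.mp hx; exact hU u hu
  have h1 : (U' ∪ V).card ≤ C.card := card_le_card (union_subset hU'C hV)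
  have h2 : (U' ∩ V).card = (U.filter fun u => w - u ∈ V).card := by
    have : U' ∩ V = (U.filter fun u => w - u ∈ V).image fun u => w - u := by
      ext x
      simp only [U', mem_inter, mem_image, mem_filter]
      constructor
      · rintro ⟨⟨u, hu, rfl⟩, hx⟩; exact ⟨u, ⟨hu, hx⟩, rfl⟩
      · rintro ⟨u, ⟨hu, hx⟩, rfl⟩; exact ⟨⟨u, hu, rfl⟩, hx⟩
    rw [this, card_image_of_injOn (fun u hu u' hu' h => hinj (mem_filter.mp hu).1 (mem_filter.mp hu').1 h)]
  have h3 := card_union_add_card_inter U' V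
  omega

/-- `h ∣ m`, `1 ≤ m`, `need ≤ m` ⇒ `h·⌈max(need,1)/h⌉ ≤ m` (the size bound of a non-empty union of cosets). [bookkeeping] -/
theorem mul_ceilDiv_le {h m need : ℕ} (hh : 1 ≤ h) (hdvd : h ∣ m) (hm : 1 ≤ m) (hneed : need ≤ m) :
    h * ((max need 1 + h - 1) / h) ≤ m := by
  obtain ⟨j, rfl⟩ := hdvd
  have hmax : max need 1 ≤ h * j := max_le hneed hm
  have : (max need 1 + h - 1) / h ≤ j := by
    rw [Nat.div_le_iff_le_mul_add_pred hh]
    generalize h * j = m at hmax ⊢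
    omega
  exact Nat.mul_le_mul_left h this

end Generic

section Class

variable {H : Type} [AddCommGroup H] [Fintype H] [DecidableEq H] {N : ℕ} {A B C : Fin N → Finset H}

omit [Fintype H] in
/-- **Grynkiewicz–Wang 2026 Thm 1.8, consumer form for this rule.**  For `t ≥ 2`, `|U|, |V| ≥ t`: either the floor
`t|U| + t|V| ≤ Σ_{s ∈ U+V} min(t, r_{U,V}(s)) + ⌊(4t² − 2t)/3⌋`, or there is a non-empty `S ⊆ U + V` of `t`-popular sums whose period group has
order `h ≥ 2` with `|U| + |V| ≤ |S| + h + t − 1` (Kneser, tree `card_add_card_le_card_add_add_card_addStab`), `|U|, |V| ≤ |S| + t − 1`, and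
`t|U| + t|V| − t·h ≤ Σ_{s ∈ U+V} min(t, r_{U,V}(s))` (the printed stabiliser bound).  Source theorem: tree KERNEL
`GrynkiewiczWang.grynkiewiczWang2026_thm_1_8` (seat mm-stpp-lit g19). [cite: GrynkiewiczWang2026, Thm 1.8] -/
theorem gw_dichotomy (U V : Finset H) {t : ℕ} (ht : 2 ≤ t) (hU : t ≤ U.card) (hV : t ≤ V.card) :
    t * U.card + t * V.card ≤ (∑ s ∈ U + V, min t (repCount U V s)) + cgw t ∨
    ∃ S : Finset H, S ⊆ U + V ∧ S.Nonempty ∧ (∀ s ∈ S, t ≤ repCount U V s) ∧ 2 ≤ S.addStab.card ∧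
      U.card + V.card + 1 ≤ S.card + S.addStab.card + t ∧ U.card + 1 ≤ S.card + t ∧ V.card + 1 ≤ S.card + t ∧
      (t : ℤ) * U.card + t * V.card - t * S.addStab.card ≤ ((∑ s ∈ U + V, min t (repCount U V s) : ℕ) : ℤ) := by
  rcases GrynkiewiczWang.grynkiewiczWang2026_thm_1_8 H U V t ht hU hV with hfl | ⟨A', hA', B', hB', hrest⟩
  · exact Or.inl hfl
  · right
    dsimp only at hrest
    obtain ⟨hl, -, hS, hH, hA'c, hB'c, -, hZ1, hZ2⟩ := hrest
    set S := (U + V).filter (fun x => t ≤ Pollard.rep U V x) with hSdef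
    have hA'ne : A'.Nonempty := card_pos.mp (by omega)
    have hB'ne : B'.Nonempty := card_pos.mp (by omega)
    have hUA : (U \ A').card + A'.card = U.card := card_sdiff_add_card_eq_card hA'
    have hVB : (V \ B').card + B'.card = V.card := card_sdiff_add_card_eq_card hB'
    have hkn := card_add_card_le_card_add_add_card_addStab A' B' hA'ne hB'ne
    rw [hS] at hkn
    have hSA : A'.card ≤ S.card := hS ▸ card_le_card_add_right hB'ne
    have hSB : B'.card ≤ S.card := hS ▸ card_le_card_add_left hA'ne
    refine ⟨S, filter_subset _ _, hS ▸ hA'ne.add hB'ne, fun s hs => (mem_filter.mp hs).2, hH, by omega, by omega,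
      by omega, hZ2.trans hZ1⟩

/-- **One class pair of an STPP family passes `ClassOK`.**  `U ⊆ X`, `V ⊆ Y`, target `T ⊆ Z′`; `CT` (`|CT| = k`) contains `T` and
`U + V`, and is a coset of the subgroup `K` in the sense that `s, g + s ∈ CT ⇒ g ∈ K`; `CV` (`|CV| = k`) contains `V` and every `w − u`
(`w ∈ T`, `u ∈ U`); `|K| = k`.  Then the number `n = Σ_{w ∈ T} r_{U,V}(w)` of pairs of `U × V` summing into `T` satisfies
`ClassOK k (max_i b_i) |U| |V| |T| n`: ceilings, pigeonhole, and for `max_i b_i < t ≤ min(|U|,|V|)` the Grynkiewicz–Wang floor or a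
size-feasible structural branch — the `t`-popular set misses `Z′` because `r_{X,Y} = b_i < t` there (`STPPRepCount.repCount_eq`), it lies in
`CT ∖ T`, Kneser bounds its size below, and its period group is a subgroup of `K` (Lagrange). [original] -/
theorem classOK_of_isSTPP (h : IsSTPP A B C) (K : AddSubgroup H) {k : ℕ} (hKk : Nat.card K = k)
    {U V T CT CV : Finset H}
    (hU : U ⊆ diffUnion A B) (hV : V ⊆ diffUnion B C) (hT : T ⊆ diffUnion A C)
    (hCT : CT.card = k) (hCV : CV.card = k) (hTC : T ⊆ CT) (hUV : U + V ⊆ CT) (hVC : V ⊆ CV)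
    (hwu : ∀ w ∈ T, ∀ u ∈ U, w - u ∈ CV) (hstab : ∀ g s : H, s ∈ CT → g + s ∈ CT → g ∈ K) :
    ClassOK k (univ.sup fun i => (B i).card) U.card V.card T.card (∑ w ∈ T, repCount U V w) := by
  set cap := univ.sup fun i => (B i).card with hcap_def
  have hwk : T.card ≤ k := hCT ▸ card_le_card hTC
  refine ⟨?_, ?_, ?_, ?_⟩
  · -- `n ≤ |U| |V|`
    calc ∑ w ∈ T, repCount U V w ≤ ∑ w, repCount U V w := sum_le_sum_of_subset (subset_univ T)
      _ = U.card * V.card := FP2.sum_repCount U V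
  · -- `n ≤ |T| · min(|U|, |V|)`
    have := sum_le_card_nsmul T (fun w => repCount U V w) (min U.card V.card)
      (fun w _ => le_min (repCount_le_card_left U V w) (repCount_le_card_right U V w))
    simpa [smul_eq_mul] using this
  · -- pigeonhole
    have := card_nsmul_le_sum T (fun w => repCount U V w) (U.card + V.card - k) (fun w hw => by
      have := card_add_card_le_card_add_repCount hVC (hwu w hw)
      rw [hCV] at this
      exact Nat.sub_le_iff_le_add'.mpr this)
    simpa [smul_eq_mul] using this
  · intro t hct htU htV
    -- `t ≥ 2`: `U` is non-empty, so some `B j` is, so `cap ≥ 1`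
    have hUne : U.Nonempty := card_pos.mp (by omega)
    obtain ⟨u₀, hu₀⟩ := hUne
    have h2t : 2 ≤ t := by
      have hu₀X := hU hu₀
      unfold diffUnion at hu₀X
      obtain ⟨j, -, hj⟩ := mem_biUnion.mp hu₀X
      obtain ⟨b, hb, a, -, -⟩ := mem_sub.mp hj
      have h1 : 1 ≤ (B j).card := card_pos.mpr ⟨b, hb⟩
      have h2 : (B j).card ≤ cap := le_sup (f := fun i => (B i).card) (mem_univ j)
      omega
    -- the common ceiling: the `t`-capped count over `U + V` is at most `n + t (k − |T|)`
    have hsum : (∑ s ∈ U + V, min t (repCount U V s)) ≤ (∑ w ∈ T, repCount U V w) + t * (k - T.card) := by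
      rw [← sum_filter_add_sum_filter_not (U + V) (· ∈ T)]
      refine Nat.add_le_add ?_ ?_
      · calc ∑ s ∈ (U + V).filter (· ∈ T), min t (repCount U V s)
            ≤ ∑ s ∈ (U + V).filter (· ∈ T), repCount U V s := sum_le_sum fun s _ => min_le_right _ _
          _ ≤ ∑ w ∈ T, repCount U V w := sum_le_sum_of_subset fun s hs => (mem_filter.mp hs).2
      · calc ∑ s ∈ (U + V).filter (fun s => ¬ s ∈ T), min t (repCount U V s)
            ≤ ∑ s ∈ (U + V).filter (fun s => ¬ s ∈ T), t := sum_le_sum fun s _ => min_le_left _ _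
          _ = ((U + V).filter (fun s => ¬ s ∈ T)).card * t := by rw [sum_const, smul_eq_mul]
          _ ≤ (CT \ T).card * t := Nat.mul_le_mul_right t (card_le_card fun s hs => by
              rw [mem_sdiff]; exact ⟨hUV (mem_filter.mp hs).1, (mem_filter.mp hs).2⟩)
          _ = t * (k - T.card) := by rw [card_sdiff_of_subset hTC, hCT, mul_comm]
    have e : t * (k - T.card) + t * T.card = t * k := by rw [← mul_add, Nat.sub_add_cancel hwk]
    rcases gw_dichotomy U V h2t htU htV with hfl | ⟨S, hSUV, hSne, hSpop, hh2, hkn, hSU, hSV, hZ⟩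
    · left
      have := hfl.trans (Nat.add_le_add_right hsum _)
      have e2 : t * (U.card + V.card + T.card) = t * U.card + t * V.card + t * T.card := by ring
      rw [e2]
      omega
    · right
      -- the popular set misses `Z′` and lies in `CT ∖ T`
      have hSsub : S ⊆ CT \ T := by
        intro s hs
        rw [mem_sdiff]
        refine ⟨hUV (hSUV hs), fun hsT => ?_⟩
        have h1 := hSpop s hs
        have h2 : repCount U V s ≤ repCount (diffUnion A B) (diffUnion B C) s := repCount_mono hU hV s
        have hsZ := hT hsT
        unfold diffUnion at hsZ
        obtain ⟨i, -, hi⟩ := mem_biUnion.mp hsZ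
        obtain ⟨c, hc, a, ha, rfl⟩ := mem_sub.mp hi
        rw [STPPRepCount.repCount_eq h ha hc] at h2
        have h3 : (B i).card ≤ cap := le_sup (f := fun i => (B i).card) (mem_univ i)
        omega
      have hScard : S.card ≤ k - T.card := by
        have := card_le_card hSsub
        rwa [card_sdiff_of_subset hTC, hCT] at this
      -- its period group is a subgroup of `K`
      have hle : AddAction.stabilizer H (S : Set H) ≤ K := by
        intro g hg
        rw [AddAction.mem_stabilizer_iff] at hg
        obtain ⟨s, hs⟩ := hSne
        have hgs : g + s ∈ S := by
          have : g +ᵥ s ∈ g +ᵥ (S : Set H) := Set.vadd_mem_vadd_set (mem_coe.mpr hs)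
          rw [hg] at this
          exact mem_coe.mp this
        exact hstab g s (hUV (hSUV hs)) (hUV (hSUV hgs))
      have hcardStab : Nat.card (AddAction.stabilizer H (S : Set H)) = S.addStab.card := by
        have e1 : ((AddAction.stabilizer H (S : Set H) : AddSubgroup H) : Set H) = (S.addStab : Set H) :=
          (Finset.coe_addStab hSne).symm
        change Nat.card ((AddAction.stabilizer H (S : Set H) : AddSubgroup H) : Set H) = S.addStab.card
        rw [e1]
        exact Nat.card_eq_finsetCard _
      have hdvd : S.addStab.card ∣ k := by
        rw [← hcardStab, ← hKk]; exact AddSubgroup.card_dvd_of_le hle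
      refine ⟨S.addStab.card, hh2, hdvd, ?_, ?_⟩
      · -- size exclusion fails: `sizeLB |U| |V| h t ≤ |S| ≤ k − |T|`
        unfold sizeLB
        refine le_trans (mul_ceilDiv_le (by omega) (Finset.card_addStab_dvd_card S) (card_pos.mpr hSne) ?_) hScard
        omega
      · -- the stabiliser bound
        have hsum' := hsum
        zify [hwk] at hsum'
        have hZ' := hZ
        push_cast at hZ' hsum'
        have key := hZ'.trans hsum'
        zify
        linarith

end Class

end GW2

end Summit.MatrixMultiplication.MatrixMultiplication.Theorems
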